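import Literature.Algebra.Homology.GroupHomologyPermutationModuleGenerators
import HarnessLib

/-!
# Degree-one Shapiro lemma for permutation modules: stabilizer symbols span `H₁(Γ, k[X])`, and for a
# transitive `Γ`-set the component map `H₁(Γ_{x₀}, k) → H₁(Γ, k[X])` is a `k`-linear equivalence (Brown III §6, §9)

Topic `Literature/Algebra/Homology`; namespace `Literature.Algebra.Homology.PermutationCoeff`; third file after
`GroupHomologyPermutationModule` (setting `φ : Γ →* S`, `S ↷ X`; `permRep`, `componentMap`, `stabSymbol`) and
`GroupHomologyPermutationModuleGenerators` (`transferElt`, the orbit-data generation theorem `mem_symbolSpan_range`).  Definitions with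
bodies and proved theorems only; no named fact, no `sorry`, no instance, no notation.

* `orbitSetoid φ`, `exists_orbitData`: orbit points `r` (valued in any `R` meeting every orbit, constant on orbits)
  and carriers `s` always exist (choice).
* **`symbolSpan_eq_top`** / `symbolSpan_univ_eq_top`: the stabilizer symbols `[γ ⊗ aδ_x]` (`x ∈ R`, `γ ∈ Γ_x`)
  span `H₁(Γ, k[X])`; **`componentMap_surjective`**: for a TRANSITIVE `X` the component map is onto
  (Shapiro, surjectivity half; Brown III (6.3)–(6.5) in degree one).
* `genClass k γ : k →ₗ[k] H₁(H, k)`, `a ↦ [γ ⊗ a]`, with `[γδ ⊗ a] = [γ ⊗ a] + [δ ⊗ a]` (`genClass_mul`).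
* `transferToStab φ x₀ s hs : C₁(Γ, k[X]) →ₗ[k] H₁(Γ_{x₀}, k)`, `[γ] ⊗ aδ_x ↦ [t(γ, x)] ⊗ a` for a section `s`
  (`φ(s x)·x₀ = x`) — the degree-one TRANSFER (Brown III §9 (A)); it kills the `1`-boundaries
  (`transferToStab_d₂₁`, by the cocycle identity `t(gh, x) = t(g, x)t(h, g⁻¹x)`) and inverts the component
  map on chains (`transferToStab_chainsMap`, normalisation `s x₀ = 1`), whence `componentMap_injective_of_section`.
* **`componentMap_bijective`**, **`componentEquiv φ x₀ htrans : H₁(Γ_{x₀}, k) ≃ₗ[k] H₁(Γ, k[X])`** — Shapiro's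
  lemma `H₁(Γ, Ind_{Γ_{x₀}}^Γ k) ≅ H₁(Γ_{x₀}, k)` in degree one for the permutation module `k[X] ≅ k[Γ/Γ_{x₀}]`,
  with both directions explicit on `1`-chains (Mathlib's `groupHomology.indIso` is the abstract all-degree
  version for `Rep.ind`; the explicit degree-one form is what chain-level consumers — period maps on modular
  symbols — need).

## References
* K. S. Brown, *Cohomology of Groups*, GTM 87 (1982), III §6 Prop. 6.2, (6.3)–(6.5); III §9. [Brown1982]
-/

noncomputable section

open CategoryTheory groupHomology Finsupp

universe u

namespace Literature.Algebra.Homology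

namespace PermutationCoeff

variable {k : Type u} [CommRing k] {Γ S : Type u} [Group Γ] [Group S] (φ : Γ →* S)
  {X : Type u} [MulAction S X]

/-! ### Orbit data exist; user-facing generation theorems -/

section OrbitData

/-- The `Γ`-orbit relation on `X` (through `φ`). [folklore] -/
def orbitSetoid : Setoid X where
  r x y := ∃ γ : Γ, φ γ • x = y
  iseqv := by
    refine ⟨fun x => ⟨1, by simp⟩, ?_, ?_⟩
    · rintro x y ⟨γ, rfl⟩
      exact ⟨γ⁻¹, by simp⟩
    · rintro x y z ⟨γ, rfl⟩ ⟨δ, rfl⟩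
      exact ⟨δ * γ, by simp [mul_smul]⟩

/-- **Orbit data.** If every `Γ`-orbit meets `R`, there are `r : X → R`-valued orbit representatives,
constant on orbits, and `s(x) ∈ Γ` carrying `r(x)` to `x`. [cite: Brown1982, Ch. III §5 (coset representatives)] -/
theorem exists_orbitData (R : Set X) (hR : ∀ x, ∃ γ : Γ, φ γ • x ∈ R) :
    ∃ (r : X → X) (s : X → Γ), (∀ x, φ (s x) • r x = x) ∧ (∀ (γ : Γ) (x : X), r (φ γ • x) = r x) ∧
      ∀ x, r x ∈ R := by
  classical
  let q : X → Quotient (orbitSetoid φ (X := X)) := fun x => Quotient.mk _ x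
  let o : X → X := fun x => (q x).out
  let γ₀ : X → Γ := fun y => Classical.choose (hR y)
  have hγ₀ : ∀ y, φ (γ₀ y) • y ∈ R := fun y => Classical.choose_spec (hR y)
  let r : X → X := fun x => φ (γ₀ (o x)) • o x
  have ho : ∀ x, ∃ γ : Γ, φ γ • o x = x := fun x => Quotient.mk_out (s := orbitSetoid φ) x
  let s : X → Γ := fun x => Classical.choose (ho x) * (γ₀ (o x))⁻¹
  refine ⟨r, s, fun x => ?_, fun γ x => ?_, fun x => hγ₀ _⟩
  · simp only [r, s, map_mul, map_inv, mul_smul, inv_smul_smul]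
    exact Classical.choose_spec (ho x)
  · have hq : q (φ γ • x) = q x := Quotient.sound ⟨γ⁻¹, by simp⟩
    simp only [r, o, hq]

/-- **Stabilizer symbols generate `H₁(Γ, k[X])`** — at the points of any `R ⊆ X` meeting every orbit.
[cite: Brown1982, Ch. III §6 Prop. 6.2 (Shapiro) and §9 Ex. 2] -/
theorem symbolSpan_eq_top (R : Set X) (hR : ∀ x, ∃ γ : Γ, φ γ • x ∈ R) : symbolSpan k φ R = ⊤ := by
  obtain ⟨r, s, hs, hr, hrR⟩ := exists_orbitData φ R hR
  refine eq_top_iff.2 fun z _ => ?_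
  have hle : symbolSpan k φ (Set.range r) ≤ symbolSpan k φ R := by
    refine Submodule.span_mono ?_
    rintro _ ⟨x, ⟨y, rfl⟩, γ, a, rfl⟩
    exact ⟨r y, hrR y, γ, a, rfl⟩
  exact hle (mem_symbolSpan_range φ r s hs hr z)

/-- All stabilizer symbols together generate `H₁(Γ, k[X])`. [cite: Brown1982, Ch. III §6 (6.5)] -/
theorem symbolSpan_univ_eq_top : symbolSpan k φ (Set.univ : Set X) = ⊤ :=
  symbolSpan_eq_top φ Set.univ fun _ => ⟨1, Set.mem_univ _⟩

/-- **Degree-one Shapiro, surjectivity half.** For a TRANSITIVE `Γ`-set `X` the component map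
`H₁(Γ_{x₀}, k) → H₁(Γ, k[X])` is surjective. [cite: Brown1982, Ch. III §6 Prop. 6.2] -/
theorem componentMap_surjective (x₀ : X) (htrans : ∀ x, ∃ γ : Γ, φ γ • x₀ = x) :
    Function.Surjective (componentMap k φ x₀) := by
  intro z
  have hz : z ∈ symbolSpan k φ ({x₀} : Set X) := by
    rw [symbolSpan_eq_top φ {x₀} (fun x => ?_)]
    · exact Submodule.mem_top
    · obtain ⟨γ, hγ⟩ := htrans x
      exact ⟨γ⁻¹, by rw [← hγ, map_inv, inv_smul_smul]; exact Set.mem_singleton _⟩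
  have hle : symbolSpan k φ ({x₀} : Set X) ≤ LinearMap.range (componentMap k φ x₀).hom := by
    refine Submodule.span_le.2 ?_
    rintro _ ⟨x, hx, γ, a, rfl⟩
    rw [Set.mem_singleton_iff] at hx
    subst hx
    exact ⟨H1π _ ((cycles₁IsoOfIsTrivial _).inv (single γ a)), componentMap_H1π_single k φ x γ a⟩
  obtain ⟨y, hy⟩ := hle hz
  exact ⟨y, hy⟩

end OrbitData


/-! ### Degree-one Shapiro, injectivity half: the explicit transfer `C₁(Γ, k[X]) → H₁(Γ_{x₀}, k)` -/

section Transfer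

variable {H : Type u} [Group H]

variable (k) in
/-- The class `[γ ⊗ a] ∈ H₁(H, k)` as a `k`-linear function of `a`. [cite: Brown1982, Ch. II §3 (`H₁(G, ℤ) = G_ab`)] -/
def genClass (γ : H) : k →ₗ[k] H1 (Rep.trivial k H k) :=
  (H1π (Rep.trivial k H k)).hom ∘ₗ (cycles₁IsoOfIsTrivial (Rep.trivial k H k)).inv.hom ∘ₗ
    Finsupp.lsingle γ

/-- Unfolding `genClass`: `[γ ⊗ a] = H1π [single γ a]`. [cite: Brown1982, Ch. II §3] -/
theorem genClass_apply (γ : H) (a : k) :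
    genClass k γ a = H1π (Rep.trivial k H k) ((cycles₁IsoOfIsTrivial _).inv (single γ a)) := rfl

/-- `[γδ ⊗ a] = [γ ⊗ a] + [δ ⊗ a]` in `H₁(H, k)`. [cite: Brown1982, Ch. II §3] -/
theorem genClass_mul (γ δ : H) (a : k) : genClass k (γ * δ) a = genClass k γ a + genClass k δ a := by
  simp only [genClass_apply, ← map_add]
  rw [eq_comm, H1π_eq_iff]
  have h := single_add_single_sub_single_mul_mem_boundaries₁ (A := Rep.trivial k H k) γ δ a
  rwa [Rep.trivial_ρ_apply] at h

/-- `[1 ⊗ a] = 0` in `H₁(H, k)`. [cite: Brown1982, Ch. II §3] -/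
theorem genClass_one (a : k) : genClass k (1 : H) a = 0 := by
  have h := genClass_mul (k := k) (1 : H) 1 a
  rw [one_mul] at h
  exact left_eq_add.1 h

end Transfer

section Injective

variable (x₀ : X) (s : X → Γ) (hs : ∀ x, φ (s x) • x₀ = x) (hs₀ : s x₀ = 1)

include hs in
/-- For a transitive `X` with section `s` over `x₀`, `t(γ, x) ∈ Γ_{x₀}`. [cite: Brown1982, Ch. III §9 (A)] -/
theorem transferElt_mem_stab (γ : Γ) (x : X) : transferElt φ s γ x ∈ stabilizerIn φ x₀ :=
  transferElt_mem φ (fun _ => x₀) s hs (fun _ _ => rfl) γ x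

/-- **The explicit transfer** `C₁(Γ, k[X]) → H₁(Γ_{x₀}, k)`: `[γ] ⊗ aδ_x ↦ [t(γ, x)] ⊗ a`. [cite: Brown1982, Ch. III §9 (A)] -/
def transferToStab : (Γ →₀ permRepObj k φ X) →ₗ[k] H1 (Rep.trivial k (stabilizerIn φ x₀) k) :=
  Finsupp.lsum k fun γ => Finsupp.lsum k fun x =>
    genClass k (⟨transferElt φ s γ x, transferElt_mem_stab φ x₀ s hs γ x⟩ : stabilizerIn φ x₀)

/-- `transferToStab([γ] ⊗ aδ_x) = [t(γ,x) ⊗ a]`. [cite: Brown1982, Ch. III §9 (A)] -/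
theorem transferToStab_single_single (γ : Γ) (x : X) (a : k) :
    transferToStab φ x₀ s hs (single γ (single x a)) =
      genClass k (⟨transferElt φ s γ x, transferElt_mem_stab φ x₀ s hs γ x⟩ : stabilizerIn φ x₀) a := by
  simp [transferToStab]

/-- The transfer kills `1`-boundaries. [cite: Brown1982, Ch. III §9 (A)] -/
theorem transferToStab_d₂₁ (w : Γ × Γ →₀ permRepObj k φ X) :
    transferToStab φ x₀ s hs (d₂₁ (permRepObj k φ X) w) = 0 := by
  induction w using Finsupp.induction_linear with
  | zero => simp
  | add w₁ w₂ h₁ h₂ => rw [map_add, map_add, h₁, h₂, add_zero]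
  | single gh f =>
    obtain ⟨g, h⟩ := gh
    induction f using Finsupp.induction_linear with
    | zero => simp
    | add f₁ f₂ h₁ h₂ => rw [single_add, map_add, map_add, h₁, h₂, add_zero]
    | single x a =>
      rw [d₂₁_single]
      have hρ : (permRepObj k φ X).ρ g⁻¹ (single x a) = single (φ g⁻¹ • x) a := permRep_single φ _ _ _
      rw [hρ, map_add (transferToStab (k := k) φ x₀ s hs), map_sub (transferToStab (k := k) φ x₀ s hs)]
      erw [transferToStab_single_single, transferToStab_single_single, transferToStab_single_single]
      have hmul : (⟨transferElt φ s (g * h) x, transferElt_mem_stab φ x₀ s hs (g * h) x⟩ :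
          stabilizerIn φ x₀) =
          ⟨transferElt φ s g x, transferElt_mem_stab φ x₀ s hs g x⟩ *
          ⟨transferElt φ s h (φ g⁻¹ • x), transferElt_mem_stab φ x₀ s hs h (φ g⁻¹ • x)⟩ :=
        Subtype.ext (transferElt_mul φ s g h x)
      rw [hmul, genClass_mul]
      abel

/-- The transfer kills `B₁(Γ, k[X])`. [cite: Brown1982, Ch. III §9 (A)] -/
theorem transferToStab_eq_zero_of_mem_boundaries₁ (c : Γ →₀ permRepObj k φ X)
    (hc : c ∈ boundaries₁ (permRepObj k φ X)) : transferToStab φ x₀ s hs c = 0 := by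
  obtain ⟨w, rfl⟩ := hc
  exact transferToStab_d₂₁ φ x₀ s hs w

include hs₀ in
/-- Transfer ∘ (component map on chains) = the quotient map `C₁(Γ_{x₀}, k) → H₁(Γ_{x₀}, k)`. [cite: Brown1982, Ch. III §9 (B) (`cor ∘ res` on the stabilizer)] -/
theorem transferToStab_chainsMap (c : stabilizerIn φ x₀ →₀ k) :
    transferToStab φ x₀ s hs (chainsMap₁ (stabilizerIn φ x₀).subtype (toPermHom k φ x₀) c) =
      H1π (Rep.trivial k (stabilizerIn φ x₀) k) ((cycles₁IsoOfIsTrivial _).inv c) := by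
  induction c using Finsupp.induction_linear with
  | zero => simp
  | add c₁ c₂ h₁ h₂ => rw [map_add, map_add, h₁, h₂, map_add, map_add]
  | single γ a =>
    simp only [ModuleCat.hom_ofHom, LinearMap.coe_comp, Function.comp_apply, lmapDomain_apply,
      mapDomain_single, mapRange.linearMap_apply, mapRange_single, Subgroup.coe_subtype]
    rw [show (toPermHom k φ x₀).hom.toLinearMap a = single x₀ a from rfl,
      transferToStab_single_single, ← genClass_apply]
    congr 2
    apply Subtype.ext
    simp only [transferElt, inv_smul_eq_of_mem_stabilizerIn φ γ.2, hs₀, inv_one, one_mul, mul_one]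

include hs hs₀ in
/-- **Degree-one Shapiro, injectivity half** (given a normalised section `s`). [cite: Brown1982, Ch. III §6 Prop. 6.2] -/
theorem componentMap_injective_of_section : Function.Injective (componentMap k φ x₀) := by
  rw [injective_iff_map_eq_zero]
  intro z hz
  induction z using H1_induction_on with
  | h c =>
    rw [componentMap, groupHomology.H1π_comp_map_apply (A := Rep.trivial k (stabilizerIn φ x₀) k)
      (B := permRepObj k φ X)] at hz
    rw [H1π_eq_zero_iff] at hz
    have h0 := transferToStab_eq_zero_of_mem_boundaries₁ φ x₀ s hs _ hz
    rw [coe_mapCycles₁, transferToStab_chainsMap φ x₀ s hs hs₀] at h0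
    have e : (cycles₁IsoOfIsTrivial (Rep.trivial k (stabilizerIn φ x₀) k)).inv c.1 = c :=
      Subtype.ext (cycles₁IsoOfIsTrivial_inv_apply _)
    rwa [e] at h0

end Injective

section Shapiro

/-- **Degree-one Shapiro lemma for a transitive `Γ`-set (explicit form).** The component map
`H₁(Γ_{x₀}, k) → H₁(Γ, k[X])`, `[γ ⊗ a] ↦ [γ ⊗ aδ_{x₀}]`, is bijective.
[cite: Brown1982, Ch. III §6 Prop. 6.2 and (6.3)] -/
theorem componentMap_bijective (x₀ : X) (htrans : ∀ x, ∃ γ : Γ, φ γ • x₀ = x) :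
    Function.Bijective (componentMap k φ x₀) := by
  refine ⟨?_, componentMap_surjective φ x₀ htrans⟩
  classical
  let s₁ : X → Γ := fun x => Classical.choose (htrans x)
  have hs₁ : ∀ x, φ (s₁ x) • x₀ = x := fun x => Classical.choose_spec (htrans x)
  let s : X → Γ := fun x => s₁ x * (s₁ x₀)⁻¹
  have hfix : (φ (s₁ x₀))⁻¹ • x₀ = x₀ := by rw [inv_smul_eq_iff, hs₁]
  have hs : ∀ x, φ (s x) • x₀ = x := fun x => by
    simp only [s, map_mul, map_inv, mul_smul, hfix, hs₁]
  have hs₀ : s x₀ = 1 := by simp [s]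
  exact componentMap_injective_of_section φ x₀ s hs hs₀

/-- The degree-one Shapiro isomorphism `H₁(Γ_{x₀}, k) ≃ H₁(Γ, k[X])` for a transitive `Γ`-set, as a
`k`-linear equivalence. [cite: Brown1982, Ch. III §6 Prop. 6.2] -/
def componentEquiv (x₀ : X) (htrans : ∀ x, ∃ γ : Γ, φ γ • x₀ = x) :
    H1 (Rep.trivial k (stabilizerIn φ x₀) k) ≃ₗ[k] H1 (permRepObj k φ X) :=
  LinearEquiv.ofBijective (componentMap k φ x₀).hom (componentMap_bijective φ x₀ htrans)

/-- `componentEquiv` is the component map. [cite: Brown1982, Ch. III §6 Prop. 6.2] -/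
@[simp] theorem componentEquiv_apply (x₀ : X) (htrans : ∀ x, ∃ γ : Γ, φ γ • x₀ = x)
    (z : H1 (Rep.trivial k (stabilizerIn φ x₀) k)) :
    componentEquiv φ x₀ htrans z = componentMap k φ x₀ z := rfl

end Shapiro

end PermutationCoeff

end Literature.Algebra.Homology
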